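import Summits.HodgeConjecture.HodgeConjecture.Theorems.LinearSystemTorelliLocalTubeSpanFrameLiftBasic

/-!
# Route LinearSystemTorelli — crux `LocalTubeSpan` (stmt-HodgeConjecture-2490): Janssen companions from the elementary level-2 moves

Helper file (`--supports stmt-HodgeConjecture-2490`, line `Sketch` of the crux chain, cycle 7,
lead c6; stub `stub_companion`).  Cycle 7 of the line derives Janssen's Theorem 2.9 (the
"companions" `δ + 2z ∈ Δ`) from Janssen's Theorem 2.5 for a skew vanishing lattice `Δ` of an
alternating form `B` on a `ℚ`-space `V` (`Γ_Δ = transvectionGroup B Δ`, Schnell's `T_v(x) = x - B(x,v)v`).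
Theorem 2.5 supplies, inside `Γ_Δ`, two families of level-2 moves, which are HYPOTHESES here:

* `hpair` — for `e, f ∈ ℤΔ` with `B(e, f) = 0`, the move `x ↦ x + 2 (B(x,e) f + B(x,f) e)`;
* `hsq` — for `a ∈ ℤΔ`, the squared transvection `T_a² : x ↦ x - 2 B(x,a) a`.

`localTubeSpan_companion`: from these two families alone, for `δ ∈ Δ` with a partner `y ∈ ℤΔ`,
`B(δ, y) = 1`, and any `z ∈ ℤΔ` with `B(z, y) = 0`, the companion `δ + 2z` lies in `Δ`.
Proof: `β := B(δ, z) ∈ ℤ`, `w := z - β y` is orthogonal to `δ` and `y`; the pair move of `(y, w)`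
sends `δ ↦ δ + 2w`, and `T_y^{∓2}` applied `|β|` times adds `2β y` (`B(δ + 2w, y) = 1`); `Δ` is
`Γ_Δ`-stable.  Two `[folklore]` helpers record powers and the inverse of a "shear unit"
`x ↦ x + (c B(x,a)) a`, `B(a,a) = 0`.

No named facts (the two move families are hypotheses); no `sorry`.
-/

-- `Summit.HodgeConjecture.HodgeConjecture.Theorems` is the mandated namespace (single-conjunct summit:
-- Sub = Summit), which `linter.dupNamespace` flags on every declaration; the lakefile turns the
-- linter off tree-wide (weak option), restated here so stand-alone elaboration is warning-free too.
set_option linter.dupNamespace false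

noncomputable section

open Literature.AlgebraicGeometry.HodgeTheory

namespace Summit.HodgeConjecture.HodgeConjecture.Theorems

/-! ### Shear units `x ↦ x + (c B(x,a)) a` -/

section Shear

variable {V : Type*} [AddCommGroup V] [Module ℚ V] (B : LinearMap.BilinForm ℚ V)

/-- Powers of a unit of `End V` acting as the shear `x ↦ x + (c B(x, a)) a` along an isotropic
vector `a` (`B(a, a) = 0`): `u ^ n` acts as `x ↦ x + (n c B(x, a)) a`. [folklore] -/
theorem localTubeSpan_shearUnit_pow_apply {u : (V →ₗ[ℚ] V)ˣ} {a : V} {c : ℚ}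
    (hu : ∀ x : V, (u : V →ₗ[ℚ] V) x = x + (c * B x a) • a) (haa : B a a = 0) (n : ℕ) (x : V) :
    ((u ^ n : (V →ₗ[ℚ] V)ˣ) : V →ₗ[ℚ] V) x = x + ((n : ℚ) * c * B x a) • a := by
  induction n with
  | zero =>
      rw [pow_zero, Units.val_one, Module.End.one_apply, Nat.cast_zero, zero_mul, zero_mul,
        zero_smul, add_zero]
  | succ n ih =>
      rw [pow_succ', Units.val_mul, Module.End.mul_apply, ih, hu]
      simp only [map_add, map_smul, LinearMap.add_apply, LinearMap.smul_apply, smul_eq_mul, haa,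
        mul_zero, add_zero, Nat.cast_succ]
      module

/-- The inverse of a unit of `End V` acting as the shear `x ↦ x + (c B(x, a)) a` along an
isotropic vector `a` (`B(a, a) = 0`) acts as the opposite shear `x ↦ x + (-c B(x, a)) a`.
[folklore] -/
theorem localTubeSpan_shearUnit_inv_apply {u : (V →ₗ[ℚ] V)ˣ} {a : V} {c : ℚ}
    (hu : ∀ x : V, (u : V →ₗ[ℚ] V) x = x + (c * B x a) • a) (haa : B a a = 0) (x : V) :
    ((u⁻¹ : (V →ₗ[ℚ] V)ˣ) : V →ₗ[ℚ] V) x = x + (-c * B x a) • a := by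
  have h1 : (u : V →ₗ[ℚ] V) (x + (-c * B x a) • a) = x := by
    rw [hu]
    simp only [map_add, map_smul, LinearMap.add_apply, LinearMap.smul_apply, smul_eq_mul, haa,
      mul_zero, add_zero]
    module
  calc ((u⁻¹ : (V →ₗ[ℚ] V)ˣ) : V →ₗ[ℚ] V) x
      = ((u⁻¹ : (V →ₗ[ℚ] V)ˣ) : V →ₗ[ℚ] V) ((u : V →ₗ[ℚ] V) (x + (-c * B x a) • a)) := by rw [h1]
    _ = x + (-c * B x a) • a := localTubeSpan_units_inv_apply_apply u _

end Shear

/-! ### Companions from the elementary level-2 families -/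

section Companion

variable {V : Type} [AddCommGroup V] [Module ℚ V]

/-- **Janssen companions from the elementary level-2 moves** (stub `stub_companion` of line
`Sketch`, cycle 7).  Let `Δ` be a skew vanishing lattice of an alternating form `B`, and suppose
`Γ_Δ` contains, for all `e, f ∈ ℤΔ` with `B(e, f) = 0`, an element acting as
`x ↦ x + 2 (B(x,e) f + B(x,f) e)`, and for all `a ∈ ℤΔ` an element acting as
`T_a² : x ↦ x - 2 B(x,a) a` (both granted by Janssen's Theorem 2.5).  Then for `δ ∈ Δ` with a
partner `y ∈ ℤΔ`, `B(δ, y) = 1`, and any `z ∈ ℤΔ` with `B(z, y) = 0`, the companion `δ + 2z` lies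
in `Δ`: writing `z = w + β y` with `β = B(δ, z) ∈ ℤ` (so `w ⟂ δ, y`), the pair move of `(y, w)`
sends `δ` to `δ + 2w`, then `|β|` applications of `T_y^{∓2}` reach `δ + 2w + 2β y = δ + 2z`, and
`Δ` is `Γ_Δ`-stable. [cite: Janssen1983, Thm. 2.9] -/
theorem localTubeSpan_companion (B : LinearMap.BilinForm ℚ V) (hB : B.IsAlt) (Δ : Set V)
    (hΔ : IsSkewVanishingLattice B Δ)
    (hpair : ∀ e ∈ Submodule.span ℤ Δ, ∀ f ∈ Submodule.span ℤ Δ, B e f = 0 →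
      ∃ g ∈ transvectionGroup B Δ, ∀ x : V,
        ((g : (V →ₗ[ℚ] V)ˣ) : V →ₗ[ℚ] V) x = x + (2 : ℚ) • (B x e • f + B x f • e))
    (hsq : ∀ a ∈ Submodule.span ℤ Δ, ∃ g ∈ transvectionGroup B Δ, ∀ x : V,
        ((g : (V →ₗ[ℚ] V)ˣ) : V →ₗ[ℚ] V) x = x - (2 : ℚ) • (B x a • a))
    {δ y z : V} (hδ : δ ∈ Δ) (hy : y ∈ Submodule.span ℤ Δ) (hδy : B δ y = 1)
    (hz : z ∈ Submodule.span ℤ Δ) (hzy : B z y = 0) :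
    δ + (2 : ℚ) • z ∈ Δ := by
  -- `β := B(δ, z)` is an integer (`B` is integral on `Δ`, `z ∈ ℤΔ`)
  obtain ⟨β, hβ⟩ : ∃ β : ℤ, B δ z = β := by
    obtain ⟨n, hn⟩ := localTubeSpan_exists_int_eq_of_mem_span_int B.flip Δ δ
      (fun x hx => by
        obtain ⟨n, hn⟩ := hΔ.integral δ hδ x hx
        exact ⟨n, by rw [LinearMap.BilinForm.flip_apply, hn]⟩) hz
    exact ⟨n, by rw [← hn, LinearMap.BilinForm.flip_apply]⟩
  -- split `z = w + β y` with `w` orthogonal to `δ` and `y`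
  obtain ⟨w, rfl⟩ : ∃ w : V, z = w + (β : ℚ) • y := ⟨z - (β : ℚ) • y, (sub_add_cancel _ _).symm⟩
  have hyy : B y y = 0 := hB.self_eq_zero y
  have hw : w ∈ Submodule.span ℤ Δ := by
    have h := Submodule.sub_mem _ hz (Submodule.smul_mem _ β hy)
    rwa [← Int.cast_smul_eq_zsmul ℚ β y, add_sub_cancel_right] at h
  have hwy : B w y = 0 := by
    rwa [map_add, map_smul, LinearMap.add_apply, LinearMap.smul_apply, hyy, smul_zero,
      add_zero] at hzy
  have hyw : B y w = 0 := by rw [← hB.neg_eq w y, hwy, neg_zero]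
  have hδw : B δ w = 0 := by
    rw [map_add, map_smul, hδy, smul_eq_mul, mul_one] at hβ
    linear_combination hβ
  -- Step 1: the pair move of `(y, w)` sends `δ` to `δ + 2w`
  obtain ⟨g₁, hg₁, hg₁x⟩ := hpair y hy w hw hyw
  have hg₁δ : ((g₁ : (V →ₗ[ℚ] V)ˣ) : V →ₗ[ℚ] V) δ = δ + (2 : ℚ) • w := by
    rw [hg₁x, hδy, hδw, one_smul, zero_smul, add_zero]
  -- Step 2: `T_y²` is the shear along `y` with coefficient `-2`, its inverse the one with `2`
  obtain ⟨g₂, hg₂, hg₂x⟩ := hsq y hy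
  have hshear : ∀ x : V, ((g₂ : (V →ₗ[ℚ] V)ˣ) : V →ₗ[ℚ] V) x = x + ((-2 : ℚ) * B x y) • y :=
    fun x => by
      rw [hg₂x]
      module
  have hshear_inv : ∀ x : V,
      ((g₂⁻¹ : (V →ₗ[ℚ] V)ˣ) : V →ₗ[ℚ] V) x = x + ((2 : ℚ) * B x y) • y := fun x => by
    rw [localTubeSpan_shearUnit_inv_apply B hshear hyy, neg_neg]
  have hδwy : B (δ + (2 : ℚ) • w) y = 1 := by
    rw [map_add, map_smul, LinearMap.add_apply, LinearMap.smul_apply, hδy, hwy, smul_zero,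
      add_zero]
  -- an element of `Γ_Δ` carrying `δ` to `δ + 2z`
  obtain ⟨g, hg, hgδ⟩ : ∃ g ∈ transvectionGroup B Δ,
      ((g : (V →ₗ[ℚ] V)ˣ) : V →ₗ[ℚ] V) δ = δ + (2 : ℚ) • (w + (β : ℚ) • y) := by
    obtain ⟨m, rfl | rfl⟩ := Int.eq_nat_or_neg β
    · -- `β = m ≥ 0`: add `2m y` with `(T_y²)⁻¹` applied `m` times
      refine ⟨g₂⁻¹ ^ m * g₁, mul_mem (pow_mem (inv_mem hg₂) m) hg₁, ?_⟩
      rw [Units.val_mul, Module.End.mul_apply, hg₁δ,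
        localTubeSpan_shearUnit_pow_apply B hshear_inv hyy m, hδwy]
      push_cast
      module
    · -- `β = -m ≤ 0`: subtract `2m y` with `T_y²` applied `m` times
      refine ⟨g₂ ^ m * g₁, mul_mem (pow_mem hg₂ m) hg₁, ?_⟩
      rw [Units.val_mul, Module.End.mul_apply, hg₁δ,
        localTubeSpan_shearUnit_pow_apply B hshear hyy m, hδwy]
      push_cast
      module
  rw [← hgδ]
  exact hΔ.stable g hg δ hδ

end Companion

end Summit.HodgeConjecture.HodgeConjecture.Theorems

end
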